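import Literature.Probability.LatticeModels.CurrentsPartialMonotonicity
import HarnessLib

/-!
# Moving the sources to an intersection site (Aizenman–Duminil-Copin 2021, §4.1, the switching step in the proof of Theorem 1.3)

Topic `Literature/Probability/LatticeModels`. For edge couplings `K ≥ 0` on a finite simple graph `G`
(`WeightedCurrents.lean`: `ℝ≥0∞` pair weights `epairWeight K A B (n₁,n₂) = 1{∂n₁=A}1{∂n₂=B} w w`,
clusters `C_n(x) = Current.cluster n x`), the derivation of the improved tree diagram bound from the
intersection-clustering bound (Aizenman–Duminil-Copin 2021, arXiv:1912.07973, §4.1, proof of Thm 1.3,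
the display bounding `P^{xy,zt,∅,∅}[0 < |𝒯| < 2^{δK/5}]`; repeated verbatim in §6.1) uses "the
switching lemma" in the form

  `P^{xy,zt,∅,∅}[u ∈ 𝒯, E] = (⟨σ_uσ_x⟩⟨σ_uσ_y⟩⟨σ_uσ_z⟩⟨σ_uσ_t⟩ / ⟨σ_xσ_y⟩⟨σ_zσ_t⟩) · P^{ux,uz,uy,ut}[E]`,

`𝒯 = C_{n₁+n₃}(x) ∩ C_{n₂+n₄}(z)`, for events `E` depending on the currents through the sums `n₁+n₃`,
`n₂+n₄` (e.g. `E = {M_u(𝒯; 𝓛, K) < δK}`): on `{u ∈ 𝒯}` the two pairs of sources `{x,y}`, `{z,t}`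
are rerouted through `u`. This file proves it in un-normalised current-sum form (all four two-point
functions and the two denominators become the source constraints of the pair weights):

* `Current.tsum_epairWeight_mul_connInd_mul_eq_switch` — one double current:
  `∑ 1{∂n₁=xy}1{∂n₃=∅} w w 𝟙[u ∈ C_{n₁+n₃}(x)] Φ(n₁+n₃) = ∑ 1{∂n₁=yu}1{∂n₃=xu} w w Φ(n₁+n₃)`
  (the tree's pair switching `Current.tsum_epairWeight_switch_pair`, Panis 2023 Lemma 4.4);
* `Current.tsum_prod_connInd_mul_connInd_mul_eq_switch` — the product of two independent double
  currents, `Φ` a function of `(n₁+n₃, n₂+n₄)`;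
* `Current.cluster_eq_of_mem` and `Current.tsum_prod_inter_mul_eq_switch_cluster` — the same with
  `Φ` a function of the two clusters, re-based at `u` on the right
  (`C_{n₁+n₃}(x) = C_{n₁+n₃}(u)` when `∂n₃ = {x,u}`): for `Ψ : Finset V → Finset V → ℝ≥0∞`,
  `∑_{p,q} W_{xy,zt}(p,q) 𝟙[u ∈ C_p(x)] 𝟙[u ∈ C_q(z)] Ψ(C_p(x), C_q(z)) = ∑_{p,q} W_u(p,q) Ψ(C_p(u), C_q(u))`
  with `W_{xy,zt}(p,q) = epairWeight {x,y} ∅ p · epairWeight {z,t} ∅ q` and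
  `W_u(p,q) = epairWeight {y,u} {x,u} p · epairWeight {t,u} {z,u} q` (the measure `P^{uy,ux} ⊗ P^{ut,uz}`,
  i.e. `P^{ux,uz,uy,ut}` up to the ordering of the four currents).

No named fact is introduced; everything is proved.

## References

* M. Aizenman, H. Duminil-Copin, Ann. of Math. 194 (2021), arXiv:1912.07973, §4.1 (proof of Thm 1.3,
  the equality in the display for `P[0 < |𝒯| < 2^{δK/5}]`) and §6.1 [AizenmanDuminilCopinAnnals2021].
* R. Panis, arXiv:2309.05797 (2023), Lemma 4.4 [Panis2023Triviality] — through
  `WeightedCurrentsIdentities.lean`.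
-/

noncomputable section

open Finset Filter
open scoped symmDiff ENNReal

namespace Literature.Probability.LatticeModels

variable {V : Type*} [Fintype V] [DecidableEq V] {G : SimpleGraph V} [DecidableRel G.Adj]

namespace Current

variable {K : G.edgeFinset → ℝ}

omit [DecidableEq V] in
/-- Clusters are classes: if `u ∈ C_n(x)` then `C_n(u) = C_n(x)`. [folklore] -/
theorem cluster_eq_of_mem {n : Current G} {x u : V} (h : u ∈ n.cluster x) : n.cluster u = n.cluster x := by
  ext v
  exact ⟨fun hv => mem_cluster_trans h hv, fun hv => mem_cluster_trans (mem_cluster_comm.1 h) hv⟩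

/-- **Rerouting one pair of sources through a connected site** (the switching lemma): for `K ≥ 0`,
vertices `x y u` and `Φ ≥ 0` on currents,
`∑ 1{∂n₁=xy}1{∂n₃=∅} w w 𝟙[u ∈ C_{n₁+n₃}(x)] Φ(n₁+n₃) = ∑ 1{∂n₁=yu}1{∂n₃=xu} w w Φ(n₁+n₃)`, i.e.
`P^{xy,∅}[u ∈ C(x), E] · Z[xy]Z[∅] = P^{yu,xu}[E] · Z[yu]Z[xu]` for events `E` of `n₁+n₃`.
[cite: AizenmanDuminilCopinAnnals2021, arXiv:1912.07973 §4.1, proof of Thm 1.3 (switching step)] -/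
theorem tsum_epairWeight_mul_connInd_mul_eq_switch (hK : ∀ e, 0 ≤ K e) (x y u : V)
    (Φ : Current G → ℝ≥0∞) :
    ∑' p, epairWeight K ({x} ∆ {y}) ∅ p * (connInd u x p * Φ (p.1 + p.2)) =
      ∑' p, epairWeight K ({y} ∆ {u}) ({x} ∆ {u}) p * Φ (p.1 + p.2) := by
  have h := tsum_epairWeight_switch_pair hK ({x} ∆ {y}) x u Φ
  rw [symmDiff_symmDiff_symmDiff_left] at h
  rw [h]
  refine tsum_congr fun p => ?_
  unfold connInd
  ring

/-- **Rerouting both pairs of sources through a common site**: for `K ≥ 0`, vertices `x y z t u` and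
`Φ ≥ 0` on pairs of currents,
`∑_{p,q} 1{xy}1{∅}(p) 1{zt}1{∅}(q) w⁴ 𝟙[u ∈ C_p(x)] 𝟙[u ∈ C_q(z)] Φ(p₁+p₂, q₁+q₂)`
`= ∑_{p,q} 1{yu}1{xu}(p) 1{tu}1{zu}(q) w⁴ Φ(p₁+p₂, q₁+q₂)`, i.e.
`P^{xy,zt,∅,∅}[u ∈ 𝒯, E] = (⟨σ_uσ_x⟩⟨σ_uσ_y⟩⟨σ_uσ_z⟩⟨σ_uσ_t⟩/⟨σ_xσ_y⟩⟨σ_zσ_t⟩) P^{ux,uz,uy,ut}[E]`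
(Aizenman–Duminil-Copin 2021, §4.1). [cite: AizenmanDuminilCopinAnnals2021, arXiv:1912.07973 §4.1, proof of Thm 1.3 (switching step)] -/
theorem tsum_prod_connInd_mul_connInd_mul_eq_switch (hK : ∀ e, 0 ≤ K e) (x y z t u : V)
    (Φ : Current G → Current G → ℝ≥0∞) :
    ∑' pq : (Current G × Current G) × (Current G × Current G),
        epairWeight K ({x} ∆ {y}) ∅ pq.1 * epairWeight K ({z} ∆ {t}) ∅ pq.2 *
          (connInd u x pq.1 * connInd u z pq.2 * Φ (pq.1.1 + pq.1.2) (pq.2.1 + pq.2.2)) =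
      ∑' pq : (Current G × Current G) × (Current G × Current G),
        epairWeight K ({y} ∆ {u}) ({x} ∆ {u}) pq.1 * epairWeight K ({t} ∆ {u}) ({z} ∆ {u}) pq.2 *
          Φ (pq.1.1 + pq.1.2) (pq.2.1 + pq.2.2) := by
  conv_lhs => rw [ENNReal.tsum_prod']
  conv_rhs => rw [ENNReal.tsum_prod']
  show ∑' p, ∑' q, epairWeight K ({x} ∆ {y}) ∅ p * epairWeight K ({z} ∆ {t}) ∅ q *
      (connInd u x p * connInd u z q * Φ (p.1 + p.2) (q.1 + q.2)) =
    ∑' p, ∑' q, epairWeight K ({y} ∆ {u}) ({x} ∆ {u}) p * epairWeight K ({t} ∆ {u}) ({z} ∆ {u}) q *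
      Φ (p.1 + p.2) (q.1 + q.2)
  -- switch the second pair inside (for each `p`), then the first pair outside (for each `q`)
  have hinner : ∀ p : Current G × Current G,
      ∑' q : Current G × Current G, epairWeight K ({x} ∆ {y}) ∅ p * epairWeight K ({z} ∆ {t}) ∅ q *
          (connInd u x p * connInd u z q * Φ (p.1 + p.2) (q.1 + q.2)) =
        ∑' q : Current G × Current G, epairWeight K ({x} ∆ {y}) ∅ p * (connInd u x p *
          (epairWeight K ({t} ∆ {u}) ({z} ∆ {u}) q * Φ (p.1 + p.2) (q.1 + q.2))) := by
    intro p
    rw [ENNReal.tsum_mul_left, ENNReal.tsum_mul_left,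
      ← tsum_epairWeight_mul_connInd_mul_eq_switch hK z t u (Φ (p.1 + p.2)), ← ENNReal.tsum_mul_left,
      ← ENNReal.tsum_mul_left]
    exact tsum_congr fun q => by ring
  have houter : ∀ q : Current G × Current G,
      ∑' p : Current G × Current G, epairWeight K ({x} ∆ {y}) ∅ p * (connInd u x p *
          (epairWeight K ({t} ∆ {u}) ({z} ∆ {u}) q * Φ (p.1 + p.2) (q.1 + q.2))) =
        ∑' p : Current G × Current G, epairWeight K ({y} ∆ {u}) ({x} ∆ {u}) p *
          (epairWeight K ({t} ∆ {u}) ({z} ∆ {u}) q * Φ (p.1 + p.2) (q.1 + q.2)) := fun q =>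
    tsum_epairWeight_mul_connInd_mul_eq_switch hK x y u
      (fun m => epairWeight K ({t} ∆ {u}) ({z} ∆ {u}) q * Φ m (q.1 + q.2))
  rw [tsum_congr hinner, ENNReal.tsum_comm, tsum_congr houter, ENNReal.tsum_comm]
  exact tsum_congr fun p => tsum_congr fun q => by ring

/-- **Rerouting through `u` and re-basing the clusters at `u`**: for `K ≥ 0`, vertices `x y z t u` and
`Ψ ≥ 0` a function of the two clusters,
`∑_{p,q} 1{xy}1{∅}(p) 1{zt}1{∅}(q) w⁴ 𝟙[u ∈ C_p(x)] 𝟙[u ∈ C_q(z)] Ψ(C_p(x), C_q(z))`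
`= ∑_{p,q} 1{yu}1{xu}(p) 1{tu}1{zu}(q) w⁴ Ψ(C_p(u), C_q(u))`
(`C_p = C_{p₁+p₂}`): under the rerouted sources `x ∈ C_p(u)` and `z ∈ C_q(u)`, so the intersection
set `𝒯 = C_p(x) ∩ C_q(z)` of Aizenman–Duminil-Copin 2021, §4.1 reads `C_p(u) ∩ C_q(u)` on the right,
the form in which the clustering bound (Prop. 4.3 / 6.1, `P^{ux,uz,uy,ut}[M_u(𝒯;𝓛,K) < δK]`) is applied.
[cite: AizenmanDuminilCopinAnnals2021, arXiv:1912.07973 §4.1, proof of Thm 1.3 (switching step)] -/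
theorem tsum_prod_inter_mul_eq_switch_cluster (hK : ∀ e, 0 ≤ K e) (x y z t u : V)
    (Ψ : Finset V → Finset V → ℝ≥0∞) :
    ∑' pq : (Current G × Current G) × (Current G × Current G),
        epairWeight K ({x} ∆ {y}) ∅ pq.1 * epairWeight K ({z} ∆ {t}) ∅ pq.2 *
          (connInd u x pq.1 * connInd u z pq.2 *
            Ψ ((pq.1.1 + pq.1.2).cluster x) ((pq.2.1 + pq.2.2).cluster z)) =
      ∑' pq : (Current G × Current G) × (Current G × Current G),
        epairWeight K ({y} ∆ {u}) ({x} ∆ {u}) pq.1 * epairWeight K ({t} ∆ {u}) ({z} ∆ {u}) pq.2 *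
          Ψ ((pq.1.1 + pq.1.2).cluster u) ((pq.2.1 + pq.2.2).cluster u) := by
  rw [tsum_prod_connInd_mul_connInd_mul_eq_switch hK x y z t u (fun m m' => Ψ (m.cluster x) (m'.cluster z))]
  refine tsum_congr fun pq => ?_
  by_cases h1 : pq.1.2.sources = {x} ∆ {u}
  · by_cases h2 : pq.2.2.sources = {z} ∆ {u}
    · have hu1 : u ∈ (pq.1.1 + pq.1.2).cluster x := mem_cluster_add_of_sources_eq_right _ h1
      have hu2 : u ∈ (pq.2.1 + pq.2.2).cluster z := mem_cluster_add_of_sources_eq_right _ h2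
      rw [cluster_eq_of_mem hu1, cluster_eq_of_mem hu2]
    · rw [epairWeight_eq_mul K ({t} ∆ {u}), if_neg h2]
      simp only [mul_zero, zero_mul]
  · rw [epairWeight_eq_mul K ({y} ∆ {u}), if_neg h1]
    simp only [mul_zero, zero_mul]

end Current

end Literature.Probability.LatticeModels
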